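import Mathlib
import Summits.KontsevichZagierPeriods.KontsevichZagierPeriods.Theorems.InverseLandauTateFamilyKernelStubEulerTower
import Summits.KontsevichZagierPeriods.KontsevichZagierPeriods.Theorems.InverseLandauTateFamilyKernelStubEulerBandExact
import Summits.KontsevichZagierPeriods.KontsevichZagierPeriods.Theorems.InverseLandauTateFamilyKernelStubEulerDivergence

/-!
# Crux `TateFamilyKernel` (stmt-KontsevichZagierPeriods-9130), line `Sketch`:
# stub `stub_eulerBandMulti` (wave 13, Euler sector — the MULTI-WEIGHT exact face band)

Euler sector of the lead's skeleton of the crux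
`Summit.KontsevichZagierPeriods.KontsevichZagierPeriods.Theses.InverseLandau.TateFamilyKernel`
(route `InverseLandau`). For a quasi-homogeneous pencil the per-weight reductions (A), (B) leave on
the `(s,t)`-square (`X 0 = s`, `X 1 = t`, `X 2 ↦ ϖ₀`; evaluation `aeval (Fin.snoc y ϖ₀)`) the band
integrand `ρ(y) = Σ_{w ∈ W} t^{λ_w − 1}·ĵ_w(y)`, `λ_w = w + a + b`, `ĵ_w = M w 0 / Dab`, `Dab = Q_a·Q_b`
the product of the two face denominators (non-vanishing on the closed square). The `δ = t∂_t`-tower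
of `ĵ_w` is the explicit polynomial data `H w i = M w i / Dab^{i+1}` (`hMS` + quotient rule:
`t·∂_t (H w i) = H w (i+1)`).

Proof of `stub_eulerBandMulti`: for fixed `y` and each `w ∈ W` the landed tower identity
`stub_eulerTower` (file `…StubEulerTower.lean`) gives a function `K_w` of `t` with
`∂_t K_w = ε(t)·Σ_i e_{w,i} H w i − t^{λ_w−1} H w 0`, `K_w|_{t=1} = K_w|_{t=0} = 0`
(`ε(t) = Σ_u t^{λ_u−1}/c_u`, `e_w = ∏_{v≠w}(X + λ_v)`). Summing over `w` and using the tame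
`s`-primitive `E` of the telescoped family `ĵ_L = Σ_w Σ_i e_{w,i} H w i` with equal end values,

  `ρ = ∂_s(ε·E) − (ε E)|_{s=1} + (ε E)|_{s=0}  +  ∂_t(−K) − (−K)|_{t=1} + (−K)|_{t=0}`

on the square: two Ayoub elements with tame data, hence a relation by
`tame_sum_relA_mem_relations` (file `…TameCertificate.lean`). The abstract form (any tame tower
`H`, `H'`) is `EulerBandMulti.band_mem_relations`; the registered signature instantiates it with the
slices `M w i / Dab^{i+1}` (`analyticOnNhd_slice`, `isSemialgebraicFunOn_slice`,
`hasDerivAt_slice_update` of `…RationalCertificate.lean`; the coordinate bookkeeping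
`EulerDivergence.snoc_apply_one` is the landed one of `…StubEulerDivergence.lean`).

References: Kontsevich–Zagier 2001, §1.2 (rules (1)–(3)); Ayoub, EMS Newsl. 91 (2014), Def. 10.
Mathlib plus landed sibling files; no named fact, no new definition. Helpers live in the
sub-namespace `EulerBandMulti`.
-/

noncomputable section

open MeasureTheory Set MvPolynomial
open Literature.NumberTheory.Transcendental

namespace Summit.KontsevichZagierPeriods.InverseLandau.TateFamilyKernel.Descent

namespace EulerBandMulti

/-! ### Tame data on the cube: analytic near `[0,1]ⁿ` and `ℚ`-semialgebraic on it -/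

variable {n : ℕ}

/-- A `ℚ`-polynomial function of the cube variables is tame (analytic near the cube,
`ℚ`-semialgebraic on it). [cite: BochnakCosteRoy1998, §2.2] -/
theorem tame_aeval (p : MvPolynomial (Fin n) ℚ) {f : (Fin n → ℝ) → ℝ} (hf : ∀ y, f y = aeval y p) :
    AnalyticOnNhd ℝ f (KZ.cube n) ∧ IsSemialgebraicFunOn ℚ (KZ.cube n) f := by
  obtain rfl : f = fun y => aeval y p := funext hf
  exact ⟨(Literature.ModelTheory.ExponentialFields.analyticOnNhd_aeval p).mono (subset_univ _),
    isSemialgebraicFunOn_aeval KZ.isSemialgebraic_cube p⟩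

/-- A constant function whose value is (the cast of) a rational number is tame.
[cite: BochnakCosteRoy1998, §2.2] -/
theorem tame_const {x : ℝ} (q : ℚ) (hq : (q : ℝ) = x) :
    AnalyticOnNhd ℝ (fun _ : Fin n → ℝ => x) (KZ.cube n) ∧
      IsSemialgebraicFunOn ℚ (KZ.cube n) (fun _ : Fin n → ℝ => x) :=
  ⟨analyticOnNhd_const, (isSemialgebraicFunOn_ratCast KZ.isSemialgebraic_cube q).congr fun _ _ => hq⟩

/-- Products of tame functions are tame. [cite: BochnakCosteRoy1998, Prop. 2.2.6] -/
theorem tame_mul {f g : (Fin n → ℝ) → ℝ}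
    (hf : AnalyticOnNhd ℝ f (KZ.cube n) ∧ IsSemialgebraicFunOn ℚ (KZ.cube n) f)
    (hg : AnalyticOnNhd ℝ g (KZ.cube n) ∧ IsSemialgebraicFunOn ℚ (KZ.cube n) g) :
    AnalyticOnNhd ℝ (fun y => f y * g y) (KZ.cube n) ∧
      IsSemialgebraicFunOn ℚ (KZ.cube n) (fun y => f y * g y) :=
  ⟨hf.1.mul hg.1, IsSemialgebraicFunOn.mul_holds hf.2 hg.2⟩

/-- Differences of tame functions are tame. [cite: BochnakCosteRoy1998, Prop. 2.2.6] -/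
theorem tame_sub {f g : (Fin n → ℝ) → ℝ}
    (hf : AnalyticOnNhd ℝ f (KZ.cube n) ∧ IsSemialgebraicFunOn ℚ (KZ.cube n) f)
    (hg : AnalyticOnNhd ℝ g (KZ.cube n) ∧ IsSemialgebraicFunOn ℚ (KZ.cube n) g) :
    AnalyticOnNhd ℝ (fun y => f y - g y) (KZ.cube n) ∧
      IsSemialgebraicFunOn ℚ (KZ.cube n) (fun y => f y - g y) :=
  ⟨fun y hy => (hf.1 y hy).fun_sub (hg.1 y hy), IsSemialgebraicFunOn.sub_holds hf.2 hg.2⟩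

/-- Negatives of tame functions are tame. [cite: BochnakCosteRoy1998, Prop. 2.2.6] -/
theorem tame_neg {f : (Fin n → ℝ) → ℝ}
    (hf : AnalyticOnNhd ℝ f (KZ.cube n) ∧ IsSemialgebraicFunOn ℚ (KZ.cube n) f) :
    AnalyticOnNhd ℝ (fun y => -f y) (KZ.cube n) ∧
      IsSemialgebraicFunOn ℚ (KZ.cube n) (fun y => -f y) :=
  ⟨fun y hy => (hf.1 y hy).fun_neg, hf.2.neg⟩

/-- Finite sums of tame functions are tame. [cite: BochnakCosteRoy1998, Prop. 2.2.6] -/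
theorem tame_sum {ι : Type*} (s : Finset ι) {F : ι → (Fin n → ℝ) → ℝ}
    (h : ∀ k ∈ s, AnalyticOnNhd ℝ (F k) (KZ.cube n) ∧ IsSemialgebraicFunOn ℚ (KZ.cube n) (F k)) :
    AnalyticOnNhd ℝ (fun y => ∑ k ∈ s, F k y) (KZ.cube n) ∧
      IsSemialgebraicFunOn ℚ (KZ.cube n) (fun y => ∑ k ∈ s, F k y) :=
  ⟨Finset.analyticOnNhd_fun_sum s fun k hk => (h k hk).1,
    KZ.isSemialgebraicFunOn_finset_sum s KZ.isSemialgebraic_cube fun k hk => (h k hk).2⟩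

/-- Updating one coordinate of a point of the cube inside `[0,1]` stays in the cube. [folklore] -/
theorem update_mem_cube {y : Fin n → ℝ} (hy : y ∈ KZ.cube n) (i : Fin n) {τ : ℝ}
    (hτ : τ ∈ Icc (0 : ℝ) 1) : Function.update y i τ ∈ KZ.cube n := by
  intro j
  by_cases h : j = i
  · subst h
    rw [Function.update_self]
    exact ⟨hτ.1, hτ.2⟩
  · rw [Function.update_of_ne h]
    exact KZ.mem_cube.1 hy j

/-! ### The `δ`-tower of a polynomial quotient -/

/-- **One step of the `δ = t∂_t`-tower.** For polynomial data `A/D^{i+1}` (three variables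
`s, t, ϖ`, evaluated at `(y, ϖ₀)` with `D(y, ϖ₀) ≠ 0`), `t` times the Griffiths form of
`∂_t(A/D^{i+1})` is `t·(∂_tA·D − (i+1)·A·∂_tD)/D^{i+2}`. [folklore] -/
theorem delta_step (A D : MvPolynomial (Fin (2 + 1)) ℚ) (i : ℕ) (y : Fin 2 → ℝ) (ϖ₀ : ℝ)
    (hD : aeval (Fin.snoc y ϖ₀ : Fin (2 + 1) → ℝ) D ≠ 0) :
    y 1 * (aeval (Fin.snoc y ϖ₀ : Fin (2 + 1) → ℝ)
          (pderiv 1 A * D ^ (i + 1) - A * pderiv 1 (D ^ (i + 1))) /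
        aeval (Fin.snoc y ϖ₀ : Fin (2 + 1) → ℝ) ((D ^ (i + 1)) ^ 2)) =
      aeval (Fin.snoc y ϖ₀ : Fin (2 + 1) → ℝ)
          (X 1 * (pderiv 1 A * D - C ((i : ℚ) + 1) * A * pderiv 1 D)) /
        aeval (Fin.snoc y ϖ₀ : Fin (2 + 1) → ℝ) (D ^ (i + 1 + 1)) := by
  simp only [pderiv_pow, Nat.add_sub_cancel, map_sub, map_mul, map_pow, map_natCast, aeval_X,
    MvPolynomial.aeval_C, eq_ratCast, Rat.cast_add, Rat.cast_natCast, Rat.cast_one,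
    EulerDivergence.snoc_apply_one]
  push_cast
  field_simp
  ring

/-! ### The abstract multi-weight band -/

/-- **The multi-weight exact face band is a relation** (abstract form). Data on the square
`[0,1]²` (coordinates `s = y 0`, `t = y 1`): a finite set of weights `W` with offset `c`
(`u + c ≥ 1` on `W`); a tame `δ`-tower `H w i` (`t·∂_t H w i = H w (i+1)`, `∂_t` along the
coordinate `1` with derivative `H' w i`); a tame `s`-primitive `E` of the telescoped family
`ĵ_L = Σ_w Σ_i e_{w,i}·H w i` (`e_w = ∏_{v ∈ W∖w}(X + (v + c))`) with `E|_{s=1} = E|_{s=0}`. Then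
every tame cube representation of the band `Σ_w t^{w+c−1}·H w 0` is a relation: by the tower
identity `stub_eulerTower`, the band equals `∂_s(εE) − (εE)|_{s=1} + (εE)|_{s=0}` plus
`∂_t(−K) − (−K)|_{t=1} + (−K)|_{t=0}` on the square (`K|_{t=0} = K|_{t=1} = 0`), two Ayoub
elements with tame data (`tame_sum_relA_mem_relations`).
[cite: KontsevichZagier2001, §1.2] [cite: Ayoub2014, Def. 10] -/
theorem band_mem_relations (W : Finset ℕ) (c : ℕ) (hW : ∀ u ∈ W, 1 ≤ u + c)
    (H H' : ℕ → ℕ → (Fin 2 → ℝ) → ℝ)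
    (hHa : ∀ w i, AnalyticOnNhd ℝ (H w i) (KZ.cube 2))
    (hHs : ∀ w i, IsSemialgebraicFunOn ℚ (KZ.cube 2) (H w i))
    (hder : ∀ w i, ∀ y ∈ KZ.cube 2,
      HasDerivAt (fun τ : ℝ => H w i (Function.update y 1 τ)) (H' w i y) (y 1))
    (hδ : ∀ w i, ∀ y ∈ KZ.cube 2, y 1 * H' w i y = H w (i + 1) y)
    (E : (Fin 2 → ℝ) → ℝ) (hEa : AnalyticOnNhd ℝ E (KZ.cube 2)) (hEs : IsSemialgebraicFunOn ℚ (KZ.cube 2) E)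
    (hE : ∀ y ∈ KZ.cube 2, HasDerivAt (fun σ : ℝ => E (Function.update y 0 σ))
      (∑ w ∈ W, ∑ i ∈ Finset.range W.card,
        (((∏ v ∈ W.erase w, (Polynomial.X + Polynomial.C ((v + c : ℕ) : ℚ))).coeff i : ℚ) : ℝ) *
          H w i y) (y 0))
    (hE01 : ∀ y ∈ KZ.cube 2, E (Function.update y 0 1) = E (Function.update y 0 0))
    (rb : KZ.IntegralRep 2) (hrb : rb.IsTameCube)
    (hrbi : ∀ y ∈ KZ.cube 2, rb.integrand y = ∑ w ∈ W, y 1 ^ (w + c - 1) * H w 0 y) :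
    KZ.of rb ∈ KZ.relations := by
  classical
  have h10 : (1 : Fin 2) ≠ 0 := by decide
  have hIcc : ∀ y ∈ KZ.cube 2, y 1 ∈ Icc (0 : ℝ) 1 := fun y hy =>
    ⟨(KZ.mem_cube.1 hy 1).1, (KZ.mem_cube.1 hy 1).2⟩
  -- the node products over `ℝ` are casts of rationals
  have hccq : ∀ u : ℕ, ((∏ v ∈ W.erase u, ((v : ℚ) - u) : ℚ) : ℝ) = ∏ v ∈ W.erase u, ((v : ℝ) - u) := by
    intro u
    push_cast
    rfl
  -- names for `ε`, the telescoped family `ĵ_L = Σ_w JL w` and the primitive `K = Σ_w Kf w`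
  obtain ⟨ε, hε⟩ : ∃ ε : ℝ → ℝ, ε = fun t => ∑ u ∈ W, t ^ (u + c - 1) / ∏ v ∈ W.erase u, ((v : ℝ) - u) :=
    ⟨_, rfl⟩
  obtain ⟨JL, hJL⟩ : ∃ JL : ℕ → (Fin 2 → ℝ) → ℝ, JL = fun w y => ∑ i ∈ Finset.range W.card,
      (((∏ v ∈ W.erase w, (Polynomial.X + Polynomial.C ((v + c : ℕ) : ℚ))).coeff i : ℚ) : ℝ) * H w i y :=
    ⟨_, rfl⟩
  obtain ⟨Kf, hKf⟩ : ∃ Kf : ℕ → (Fin 2 → ℝ) → ℝ, Kf = fun w y =>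
      ∑ u ∈ W, y 1 ^ (u + c) / (∏ v ∈ W.erase u, ((v : ℝ) - u)) *
        ∑ j ∈ Finset.range W.card, (∑ i ∈ Finset.Ioo j W.card,
          (((∏ v ∈ W.erase w, (Polynomial.X + Polynomial.C ((v + c : ℕ) : ℚ))).coeff i : ℚ) : ℝ) *
            (-((u + c : ℕ) : ℝ)) ^ (i - 1 - j)) * H w j y :=
    ⟨_, rfl⟩
  -- the tower identity at a point `y` of the square, for the weight `w`
  have htower := fun (y : Fin 2 → ℝ) (hy : y ∈ KZ.cube 2) (w : ℕ) (hw : w ∈ W) =>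
    stub_eulerTower W c w hw hW (fun i τ => H w i (Function.update y 1 τ))
      (fun i τ => H' w i (Function.update y 1 τ))
      (fun i τ hτ => by
        simpa only [Function.update_idem, Function.update_self] using
          hder w i (Function.update y 1 τ) (update_mem_cube hy 1 hτ))
      (fun i τ hτ => by
        simpa only [Function.update_self] using hδ w i (Function.update y 1 τ) (update_mem_cube hy 1 hτ))
  -- tameness of the data
  have htpow : ∀ m : ℕ, AnalyticOnNhd ℝ (fun y : Fin 2 → ℝ => y 1 ^ m) (KZ.cube 2) ∧
      IsSemialgebraicFunOn ℚ (KZ.cube 2) (fun y : Fin 2 → ℝ => y 1 ^ m) := fun m =>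
    tame_aeval (X 1 ^ m) fun y => by rw [map_pow, aeval_X]
  have htp : ∀ m u : ℕ, AnalyticOnNhd ℝ (fun y : Fin 2 → ℝ => y 1 ^ m / ∏ v ∈ W.erase u, ((v : ℝ) - u)) (KZ.cube 2) ∧
      IsSemialgebraicFunOn ℚ (KZ.cube 2) (fun y : Fin 2 → ℝ => y 1 ^ m / ∏ v ∈ W.erase u, ((v : ℝ) - u)) :=
    fun m u => tame_aeval (C (∏ v ∈ W.erase u, ((v : ℚ) - u))⁻¹ * X 1 ^ m) fun y => by
      simp only [map_mul, map_pow, aeval_X, MvPolynomial.aeval_C, eq_ratCast, Rat.cast_inv]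
      rw [hccq u, div_eq_inv_mul]
  have hεt : AnalyticOnNhd ℝ (fun y : Fin 2 → ℝ => ε (y 1)) (KZ.cube 2) ∧
      IsSemialgebraicFunOn ℚ (KZ.cube 2) (fun y : Fin 2 → ℝ => ε (y 1)) := by
    simp only [hε]
    exact tame_sum W fun u _ => htp (u + c - 1) u
  have hJLt : ∀ w, AnalyticOnNhd ℝ (JL w) (KZ.cube 2) ∧ IsSemialgebraicFunOn ℚ (KZ.cube 2) (JL w) := by
    intro w
    simp only [hJL]
    exact tame_sum _ fun i _ => tame_mul (tame_const _ rfl) ⟨hHa w i, hHs w i⟩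
  have hKft : ∀ w, AnalyticOnNhd ℝ (Kf w) (KZ.cube 2) ∧ IsSemialgebraicFunOn ℚ (KZ.cube 2) (Kf w) := by
    intro w
    simp only [hKf]
    refine tame_sum W fun u _ => tame_mul (htp (u + c) u) (tame_sum _ fun j _ => tame_mul ?_ ⟨hHa w j, hHs w j⟩)
    refine tame_const (∑ i ∈ Finset.Ioo j W.card,
      (∏ v ∈ W.erase w, (Polynomial.X + Polynomial.C ((v + c : ℕ) : ℚ))).coeff i *
        (-((u + c : ℕ) : ℚ)) ^ (i - 1 - j)) ?_
    push_cast
    rfl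
  have hG₀t := tame_mul hεt ⟨hEa, hEs⟩
  have hG₀'t := tame_mul hεt (tame_sum W fun w _ => hJLt w)
  have hG₁t := tame_neg (tame_sum W fun w _ => hKft w)
  have hG₁'t := tame_neg (tame_sum W fun w _ =>
    tame_sub (tame_mul hεt (hJLt w)) (tame_mul (htpow (w + c - 1)) ⟨hHa w 0, hHs w 0⟩))
  -- the faces of `K`
  have hK1 : ∀ y ∈ KZ.cube 2, ∑ w ∈ W, Kf w (Function.update y 1 1) = 0 := fun y hy =>
    Finset.sum_eq_zero fun w hw => by
      simpa only [hKf, Function.update_self] using (htower y hy w hw).2.1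
  have hK0 : ∀ y ∈ KZ.cube 2, ∑ w ∈ W, Kf w (Function.update y 1 0) = 0 := fun y hy =>
    Finset.sum_eq_zero fun w hw => by
      simpa only [hKf, Function.update_self] using (htower y hy w hw).2.2
  -- the derivative of `K_w` along `t`
  have hKd : ∀ y ∈ KZ.cube 2, ∀ w ∈ W, HasDerivAt (fun τ : ℝ => Kf w (Function.update y 1 τ))
      (ε (y 1) * JL w y - y 1 ^ (w + c - 1) * H w 0 y) (y 1) := fun y hy w hw => by
    convert (htower y hy w hw).1 (y 1) (hIcc y hy) using 1
    · funext τ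
      simp only [hKf, Function.update_self]
    · simp only [hε, hJL, Function.update_eq_self]
  -- two Ayoub elements: direction `s` with `G₀ = ε E`, direction `t` with `G₁ = -K`
  refine tame_sum_relA_mem_relations (N := 1) Finset.univ ![(0 : Fin 2), 1]
    (G := ![fun y => ε (y 1) * E y, fun y => -∑ w ∈ W, Kf w y])
    (G' := ![fun y => ε (y 1) * ∑ w ∈ W, JL w y,
      fun y => -∑ w ∈ W, (ε (y 1) * JL w y - y 1 ^ (w + c - 1) * H w 0 y)])
    ?_ ?_ ?_ ?_ ?_ rb hrb ?_
  · rintro k -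
    fin_cases k
    · exact hG₀t.1
    · exact hG₁t.1
  · rintro k -
    fin_cases k
    · exact hG₀t.2
    · exact hG₁t.2
  · rintro k -
    fin_cases k
    · exact hG₀'t.1
    · exact hG₁'t.1
  · rintro k -
    fin_cases k
    · exact hG₀'t.2
    · exact hG₁'t.2
  · rintro k - y hy
    fin_cases k
    · show HasDerivAt (fun t : ℝ => ε (Function.update y 0 t 1) * E (Function.update y 0 t))
        (ε (y 1) * ∑ w ∈ W, JL w y) (y 0)
      simp only [Function.update_of_ne h10, hJL]
      exact (hE y hy).const_mul (ε (y 1))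
    · show HasDerivAt (fun t : ℝ => -∑ w ∈ W, Kf w (Function.update y 1 t))
        (-∑ w ∈ W, (ε (y 1) * JL w y - y 1 ^ (w + c - 1) * H w 0 y)) (y 1)
      exact (HasDerivAt.fun_sum fun w hw => hKd y hy w hw).fun_neg
  · intro y hy
    rw [Fin.sum_univ_two]
    simp only [Matrix.cons_val_zero, Matrix.cons_val_one]
    rw [hrbi y hy, hK1 y hy, hK0 y hy, Function.update_of_ne h10, Function.update_of_ne h10, hE01 y hy,
      Finset.mul_sum, Finset.sum_sub_distrib]
    ring

end EulerBandMulti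

/-- STUB `stub_eulerBandMulti` (wave 13 — the MULTI-WEIGHT EXACT FACE BAND). On the `(s,t)`-square
(`X 0 = s`, `X 1 = t`, `X 2 ↦ ϖ₀`), let `Dab = Q_a·Q_b` be the product of the two face denominators
of the reparametrised pencil (`Q_a = 1 − ϖ₀t^dT(1,s)`, `Q_b = 1 − ϖ₀t^dT(s,1)`, non-vanishing on the
closed square) and let `M w i / Dab^{i+1}` be the `δ = t∂_t`-tower of the face families
`ĵ_w = M w 0 / Dab` (`M w (i+1) = X₁·(∂₁(M w i)·Dab − (i+1)·(M w i)·∂₁Dab)`). If `E` is analytic near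
the square, `ℚ`-semialgebraic, with `∂_s E = ĵ_L := Σ_{w∈W} Σ_i e_{w,i}·(M w i/Dab^{i+1})`
(`e_w = ∏_{v∈W∖w}(X + (v+a+b))`) and `E(1,t) = E(0,t)`, then every tame representation of
`Σ_{w∈W} t^{w+a+b−1}·ĵ_w` is a KZ relation: by `stub_eulerTower` the integrand is
`relA_s(ε·E) − relA_t(K)` with `K|_{t=0} = K|_{t=1} = 0`, two Ayoub elements with tame data
(`EulerBandMulti.band_mem_relations`, an instance of `tame_sum_relA_mem_relations`). The hypothesis
`0 < d` of the skeleton is not needed for this step.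
[cite: KontsevichZagier2001, §1.2] [cite: Ayoub2014, Def. 10] -/
theorem stub_eulerBandMulti (a b d : ℕ) (hd : 0 < d) (T : MvPolynomial (Fin 2) ℚ) (W : Finset ℕ)
    (Pw : ℕ → MvPolynomial (Fin 2) ℚ) (hW : ∀ w ∈ W, 1 ≤ w + a + b)
    (ϖ₀ : ℝ) (halg : IsAlgebraic ℚ ϖ₀)
    (hadmA : ∀ y ∈ KZ.cube 2, aeval (Fin.snoc y ϖ₀ : Fin (2 + 1) → ℝ) (1 - X 2 * X 1 ^ d * bind₁ ![C 1, X 0] T) ≠ 0)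
    (hadmB : ∀ y ∈ KZ.cube 2, aeval (Fin.snoc y ϖ₀ : Fin (2 + 1) → ℝ) (1 - X 2 * X 1 ^ d * bind₁ ![X 0, C 1] T) ≠ 0)
    (M : ℕ → ℕ → MvPolynomial (Fin (2 + 1)) ℚ)
    (hM0 : ∀ w, M w 0 =
      C (a : ℚ) * bind₁ ![C 1, X 0] (Pw w) * (1 - X 2 * X 1 ^ d * bind₁ ![X 0, C 1] T) + C (b : ℚ) * bind₁ ![X 0, C 1] (Pw w) * (1 - X 2 * X 1 ^ d * bind₁ ![C 1, X 0] T))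
    (hMS : ∀ w i, M w (i + 1) =
      X 1 * (pderiv 1 (M w i) * ((1 - X 2 * X 1 ^ d * bind₁ ![C 1, X 0] T) * (1 - X 2 * X 1 ^ d * bind₁ ![X 0, C 1] T)) - C ((i : ℚ) + 1) * M w i * pderiv 1 ((1 - X 2 * X 1 ^ d * bind₁ ![C 1, X 0] T) * (1 - X 2 * X 1 ^ d * bind₁ ![X 0, C 1] T))))
    (E : (Fin 2 → ℝ) → ℝ) (hEa : AnalyticOnNhd ℝ E (KZ.cube 2)) (hEs : IsSemialgebraicFunOn ℚ (KZ.cube 2) E)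
    (hE : ∀ y ∈ KZ.cube 2, HasDerivAt (fun σ : ℝ => E (Function.update y 0 σ))
      (∑ w ∈ W, ∑ i ∈ Finset.range W.card,
        (((∏ v ∈ W.erase w, (Polynomial.X + Polynomial.C ((v + a + b : ℕ) : ℚ))).coeff i : ℚ) : ℝ) *
          (aeval (Fin.snoc y ϖ₀ : Fin (2 + 1) → ℝ) (M w i) /
            aeval (Fin.snoc y ϖ₀ : Fin (2 + 1) → ℝ) (((1 - X 2 * X 1 ^ d * bind₁ ![C 1, X 0] T) * (1 - X 2 * X 1 ^ d * bind₁ ![X 0, C 1] T)) ^ (i + 1)))) (y 0))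
    (hE01 : ∀ y ∈ KZ.cube 2, E (Function.update y 0 1) = E (Function.update y 0 0))
    (rb : KZ.IntegralRep 2) (hrb : rb.IsTameCube)
    (hrbi : ∀ y ∈ KZ.cube 2, rb.integrand y =
      ∑ w ∈ W, aeval (Fin.snoc y ϖ₀ : Fin (2 + 1) → ℝ)
          (X 1 ^ (w + a + b - 1) *
            (C (a : ℚ) * bind₁ ![C 1, X 0] (Pw w) * (1 - X 2 * X 1 ^ d * bind₁ ![X 0, C 1] T) + C (b : ℚ) * bind₁ ![X 0, C 1] (Pw w) * (1 - X 2 * X 1 ^ d * bind₁ ![C 1, X 0] T))) /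
        aeval (Fin.snoc y ϖ₀ : Fin (2 + 1) → ℝ) ((1 - X 2 * X 1 ^ d * bind₁ ![C 1, X 0] T) * (1 - X 2 * X 1 ^ d * bind₁ ![X 0, C 1] T))) :
    KZ.of rb ∈ KZ.relations := by
  -- `hd` belongs to the registered signature but is not needed for this step
  have _ := hd
  -- the common denominator `Dab = Q_a · Q_b` and its powers do not vanish on the square
  set Dab : MvPolynomial (Fin (2 + 1)) ℚ :=
    (1 - X 2 * X 1 ^ d * bind₁ ![C 1, X 0] T) * (1 - X 2 * X 1 ^ d * bind₁ ![X 0, C 1] T) with hDab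
  have hD : ∀ y ∈ KZ.cube 2, aeval (Fin.snoc y ϖ₀ : Fin (2 + 1) → ℝ) Dab ≠ 0 := fun y hy => by
    rw [hDab, map_mul]
    exact mul_ne_zero (hadmA y hy) (hadmB y hy)
  have hDp : ∀ m, ∀ y ∈ KZ.cube 2, aeval (Fin.snoc y ϖ₀ : Fin (2 + 1) → ℝ) (Dab ^ m) ≠ 0 :=
    fun m y hy => by
      rw [map_pow]
      exact pow_ne_zero m (hD y hy)
  have hW' : ∀ u ∈ W, 1 ≤ u + (a + b) := fun u hu => (add_assoc u a b) ▸ hW u hu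
  refine EulerBandMulti.band_mem_relations W (a + b) hW'
    (fun w i y => aeval (Fin.snoc y ϖ₀ : Fin (2 + 1) → ℝ) (M w i) /
      aeval (Fin.snoc y ϖ₀ : Fin (2 + 1) → ℝ) (Dab ^ (i + 1)))
    (fun w i y => aeval (Fin.snoc y ϖ₀ : Fin (2 + 1) → ℝ)
        (pderiv 1 (M w i) * Dab ^ (i + 1) - M w i * pderiv 1 (Dab ^ (i + 1))) /
      aeval (Fin.snoc y ϖ₀ : Fin (2 + 1) → ℝ) ((Dab ^ (i + 1)) ^ 2))
    (fun w i => analyticOnNhd_slice _ _ ϖ₀ (hDp (i + 1)))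
    (fun w i => isSemialgebraicFunOn_slice _ _ halg (hDp (i + 1)))
    (fun w i y hy => hasDerivAt_slice_update (M w i) (Dab ^ (i + 1)) ϖ₀ 1 y (hDp (i + 1) y hy))
    (fun w i y hy => ?_) E hEa hEs (fun y hy => ?_) hE01 rb hrb (fun y hy => ?_)
  · -- the tower step `t · ∂_t (M w i / Dab^{i+1}) = M w (i+1) / Dab^{i+2}`
    rw [hMS w i]
    exact EulerBandMulti.delta_step (M w i) Dab i y ϖ₀ (hD y hy)
  · -- the `s`-derivative of `E` is the telescoped family
    simpa only [add_assoc] using hE y hy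
  · -- the band integrand
    rw [hrbi y hy]
    refine Finset.sum_congr rfl fun w _ => ?_
    rw [EulerBandExact.aeval_X_one_pow_mul_div, ← hM0 w, zero_add, pow_one, add_assoc]

end Summit.KontsevichZagierPeriods.InverseLandau.TateFamilyKernel.Descent

end
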